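import Summits.HodgeConjecture.CorCM.GaloisLeftStabiliserInducedType
import Literature.AlgebraicGeometry.ComplexMultiplication.EndomorphismFieldNondegenerateType
import Literature.NumberTheory.ComplexMultiplication.ShimuraTaniyamaHecke
import Mathlib.FieldTheory.Galois.Basic
import HarnessLib

/-!
# The ALL-TYPES ENGINE for Galois CM fields: «every primitive type nondegenerate» + «all-types for the fixed fields of
# the admissible stabilisers» ⟹ every abelian variety with CM by the field is stably nondegenerate

COR-CM (cell `pub-hodgecm2`), binder seat b04 (gen 21), count-neutral — the recursion behind the gen-21 ALL-TYPES files
(`GaloisDicyclicAllTypes`, `CyclicCMFieldsAllTypes`, `GaloisDicyclicTimesTwoAllTypes`) stated ONCE for every Galois CM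
field read on a model `e : Gal(K/ℚ) ≃* G₀` (complex conjugation `↦ c₀`), so that further families are settled by GROUP
THEORY ALONE: determine the `v ∈ G₀`, `v ≠ 1`, with `c₀ ∉ ⟨v⟩` (the ADMISSIBLE STABILISERS — a left stabiliser of a
CM set never has `c₀` among its powers) and know the all-types property for the fixed fields `K^{e⁻¹⟨v⟩}` (CM fields;
Galois with group `G₀ ⧸ ⟨v⟩` when `⟨v⟩ ⊴ G₀`).  KERNEL ONLY: theorems; no definition, no named fact, no `sorry`.  `HC_CM`
is neither used nor claimed.

* §1 **`isStablyNondegenerate_of_forall_admissible`** — THE ENGINE: if every PRIMITIVE CM type of `K` is nondegenerate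
  and, for every admissible `v`, every abelian variety `Y` with an action of `K^{e⁻¹⟨v⟩}` and `[K^{e⁻¹⟨v⟩}:ℚ] = 2 dim Y`
  is stably nondegenerate, then EVERY `X` with `φ : K →+* End⁰(X)`, `[K:ℚ] = 2 dim X`, is stably nondegenerate.
  (THE type primitive ⟹ `X ∼ A_Φ` stably nondegenerate; imprimitive ⟹ left stabiliser `v` (part XIII), `Φ` induced
  from `K₀ = K^{e⁻¹⟨v⟩}` (part I), `X ∼ B^{[K:K₀]}` for the variety of record `B` of `(K₀; Φ₀)` — lit-hodgefound's
  `isIsogenous_powSucc_varietyOfIdeal` — and `B` carries a `K₀`-action, `exists_isCMTypeRealisation_varietyOfIdeal` +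
  `exists_ringHom_endAlgebra`.)  Variant `…_of_forall_admissible'` with the weaker recursive hypothesis «all CM types of
  `K^{e⁻¹⟨v⟩}` nondegenerate».
* §2 `isGalois_fixedField_comap_zpowers`, **`exists_mulEquiv_fixedField_quotient`** — for `⟨v⟩ ⊴ G₀`: `K^{e⁻¹⟨v⟩}/ℚ`
  is Galois with `Gal ≃* G₀ ⧸ ⟨v⟩` (Mathlib `IsGalois.normalAutEquivQuotient`, `QuotientGroup.congr`), and
  `finrank_fixedField_comap_zpowers` (`[K^{e⁻¹⟨v⟩}:ℚ] · orderOf v = [K:ℚ]`).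

## References

* [Shimura1998] G. Shimura, *Abelian Varieties with Complex Multiplication and Modular Functions* (1998), §5.1 Prop. 3,
  §6.2 Thm. 3, §8.2 Prop. 26.
* [Gordon1999HodgeAVSurvey] B. B. Gordon, *A survey of the Hodge conjecture for abelian varieties*, Thm. 6.4, Def. 7.6.
-/

noncomputable section

open CategoryTheory CategoryTheory.Limits NumberField

namespace Summit.HodgeConjecture.CorCM.GaloisRank

open Literature.NumberTheory.ComplexMultiplication
open Literature.AlgebraicGeometry Literature.AlgebraicGeometry.Motives Literature.AlgebraicGeometry.HodgeTheory
open Literature.AlgebraicGeometry.Motives.AbelianVariety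
open Literature.AlgebraicGeometry.ComplexMultiplication
open Literature.AlgebraicGeometry.Pohlmann1968

variable {G₀ : Type*} [Group G₀] [Fintype G₀]
variable {K : Type} [Field K] [NumberField K] [IsCMField K] [IsGalois ℚ K]

/-! ## §1 The engine -/

/-- **THE ALL-TYPES ENGINE.**  `K` Galois CM, `e : Gal(K/ℚ) ≃* G₀`, `e c = c₀`.  Suppose (i) every PRIMITIVE CM type of
`K` is nondegenerate, and (ii) for every `v ∈ G₀`, `v ≠ 1` with `c₀ ∉ ⟨v⟩`, every complex abelian variety `Y` with an
action of the fixed field `K₀ = K^{e⁻¹⟨v⟩}` and `[K₀:ℚ] = 2 dim Y` is stably nondegenerate.  Then EVERY complex abelian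
variety `X` with `φ : K →+* End⁰(X)` and `[K:ℚ] = 2 dim X` is stably nondegenerate.
[cite: Shimura1998, §5.1 Prop. 3, §6.2 Thm. 3, §8.2 Prop. 26] [cite: Gordon1999HodgeAVSurvey, Thm. 6.4 and Def. 7.6] -/
theorem isStablyNondegenerate_of_forall_admissible (e : (K ≃ₐ[ℚ] K) ≃* G₀) {c₀ : G₀}
    (hc : e ((IsCMField.complexConj K).restrictScalars ℚ) = c₀)
    (hprim : ∀ (Φ : CMType K) (φ₀ : K →+* ℂ), IsPrimitive (ℂ ≃+* ℂ) Φ.1 φ₀ → IsNondegenerate Φ)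
    (hsub : ∀ v : G₀, v ≠ 1 → c₀ ∉ Subgroup.zpowers v →
      ∀ (Y : AbelianVariety ℂ)
        (_ : (IntermediateField.fixedField ((Subgroup.zpowers v).comap (e : (K ≃ₐ[ℚ] K) →* G₀))) →+* Y.endAlgebra),
        Module.finrank ℚ (IntermediateField.fixedField ((Subgroup.zpowers v).comap (e : (K ≃ₐ[ℚ] K) →* G₀))) =
          2 * Y.dim → IsStablyNondegenerate Y)
    {X : AbelianVariety ℂ} (φ : K →+* X.endAlgebra) (hX : Module.finrank ℚ K = 2 * X.dim) :
    IsStablyNondegenerate X := by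
  classical
  obtain ⟨φ₀⟩ := (inferInstance : Nonempty (K →+* ℂ))
  set Φ : CMType K := cmTypeOfPair φ hX with hΦ_def
  by_cases hp : IsPrimitive (ℂ ≃+* ℂ) Φ.1 φ₀
  · exact EndFieldFullDegree.isStablyNondegenerate_of_isNondegenerate_cmTypeOfPair φ hX (hprim Φ φ₀ hp)
  · set S : Finset G₀ := Finset.univ.filter fun y => embOf φ₀ (e.symm y) ∈ Φ.1 with hS_def
    have hS : ∀ y, y ∈ S ↔ embOf φ₀ (e.symm y) ∈ Φ.1 := fun y => by
      simp only [hS_def, Finset.mem_filter, Finset.mem_univ, true_and]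
    obtain ⟨v, hv1, hv⟩ := exists_leftStabiliser_of_not_isPrimitive e Φ φ₀ S hS hp
    have hScm := model_mul_mem_iff e hc Φ φ₀ S hS
    have hcv : c₀ ∉ Subgroup.zpowers v := fun h =>
      iff_not_self ((mem_iff_mul_mem_of_mem_zpowers S hv h 1).trans (hScm 1))
    set H : Subgroup (K ≃ₐ[ℚ] K) := (Subgroup.zpowers v).comap (e : (K ≃ₐ[ℚ] K) →* G₀) with hH_def
    have hH : ∀ u ∈ H, e u ∈ Subgroup.zpowers v := fun u hu => Subgroup.mem_comap.1 hu
    haveI : IsCMField (IntermediateField.fixedField H) :=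
      isCMField_fixedField_of_not_mem H fun h => hcv (hc ▸ hH _ h)
    obtain ⟨Φ₀, hΦ₀⟩ := exists_inducedCMType_fixedField_of_leftStabiliser e Φ φ₀ S hS hv H hH
    -- `X ∼ B^{[K:K₀]}` for the variety of record `B` of `(K₀; Φ₀)`, which carries a `K₀`-action
    obtain ⟨hXB, -, -⟩ := EndFieldFullDegree.isIsogenous_powSucc_varietyOfIdeal φ hX hΦ₀
    obtain ⟨ι, θ, hB⟩ := CMTorusRealisation.exists_isCMTypeRealisation_varietyOfIdeal Φ₀
      (1 : (FractionalIdeal (nonZeroDivisors (𝓞 (IntermediateField.fixedField H))) (IntermediateField.fixedField H))ˣ)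
    obtain ⟨ψ, -⟩ := exists_ringHom_endAlgebra ι
    have hBd := finrank_eq_two_mul_dim_of_isCMTypeRealisation hB
    exact ((hsub v hv1 hcv _ ψ hBd).powSucc _).of_isIsogenous hXB

/-- **Variant with the type-level recursive hypothesis**: if every primitive CM type of `K` is nondegenerate and, for
every admissible `v`, EVERY CM type of `K^{e⁻¹⟨v⟩}` is nondegenerate (e.g. the subfield has cyclic `2`-power or
generalised quaternion Galois group), then every `X` with a `K`-action, `[K:ℚ] = 2 dim X`, is stably nondegenerate.
[cite: Shimura1998, §5.1 Prop. 3, §8.2 Prop. 26] [cite: Gordon1999HodgeAVSurvey, Thm. 6.4] -/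
theorem isStablyNondegenerate_of_forall_admissible' (e : (K ≃ₐ[ℚ] K) ≃* G₀) {c₀ : G₀}
    (hc : e ((IsCMField.complexConj K).restrictScalars ℚ) = c₀)
    (hprim : ∀ (Φ : CMType K) (φ₀ : K →+* ℂ), IsPrimitive (ℂ ≃+* ℂ) Φ.1 φ₀ → IsNondegenerate Φ)
    (hsub : ∀ v : G₀, v ≠ 1 → c₀ ∉ Subgroup.zpowers v →
      ∀ Φ₀ : CMType (IntermediateField.fixedField ((Subgroup.zpowers v).comap (e : (K ≃ₐ[ℚ] K) →* G₀))),
        IsNondegenerate Φ₀)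
    {X : AbelianVariety ℂ} (φ : K →+* X.endAlgebra) (hX : Module.finrank ℚ K = 2 * X.dim) :
    IsStablyNondegenerate X := by
  classical
  obtain ⟨φ₀⟩ := (inferInstance : Nonempty (K →+* ℂ))
  set Φ : CMType K := cmTypeOfPair φ hX with hΦ_def
  by_cases hp : IsPrimitive (ℂ ≃+* ℂ) Φ.1 φ₀
  · exact EndFieldFullDegree.isStablyNondegenerate_of_isNondegenerate_cmTypeOfPair φ hX (hprim Φ φ₀ hp)
  · set S : Finset G₀ := Finset.univ.filter fun y => embOf φ₀ (e.symm y) ∈ Φ.1 with hS_def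
    have hS : ∀ y, y ∈ S ↔ embOf φ₀ (e.symm y) ∈ Φ.1 := fun y => by
      simp only [hS_def, Finset.mem_filter, Finset.mem_univ, true_and]
    obtain ⟨v, hv1, hv⟩ := exists_leftStabiliser_of_not_isPrimitive e Φ φ₀ S hS hp
    have hScm := model_mul_mem_iff e hc Φ φ₀ S hS
    have hcv : c₀ ∉ Subgroup.zpowers v := fun h =>
      iff_not_self ((mem_iff_mul_mem_of_mem_zpowers S hv h 1).trans (hScm 1))
    set H : Subgroup (K ≃ₐ[ℚ] K) := (Subgroup.zpowers v).comap (e : (K ≃ₐ[ℚ] K) →* G₀) with hH_def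
    have hH : ∀ u ∈ H, e u ∈ Subgroup.zpowers v := fun u hu => Subgroup.mem_comap.1 hu
    haveI : IsCMField (IntermediateField.fixedField H) :=
      isCMField_fixedField_of_not_mem H fun h => hcv (hc ▸ hH _ h)
    obtain ⟨Φ₀, hΦ₀⟩ := exists_inducedCMType_fixedField_of_leftStabiliser e Φ φ₀ S hS hv H hH
    exact EndFieldFullDegree.isStablyNondegenerate_of_isNondegenerate φ hX hΦ₀ (hsub v hv1 hcv Φ₀)

/-! ## §2 The fixed field of an admissible stabiliser with `⟨v⟩ ⊴ G₀`: Galois, group `G₀ ⧸ ⟨v⟩` -/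

omit [Fintype G₀] [IsCMField K] in
/-- `K^{e⁻¹⟨v⟩}/ℚ` is Galois when `⟨v⟩ ⊴ G₀`. [folklore] -/
theorem isGalois_fixedField_comap_zpowers (e : (K ≃ₐ[ℚ] K) ≃* G₀) (v : G₀) [(Subgroup.zpowers v).Normal] :
    IsGalois ℚ (IntermediateField.fixedField ((Subgroup.zpowers v).comap (e : (K ≃ₐ[ℚ] K) →* G₀))) := by
  haveI : ((Subgroup.zpowers v).comap (e : (K ≃ₐ[ℚ] K) →* G₀)).Normal := Subgroup.normal_comap _
  exact IsGalois.of_fixedField_normal_subgroup _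

omit [Fintype G₀] [IsCMField K] in
/-- **`Gal(K^{e⁻¹⟨v⟩}/ℚ) ≃ G₀ ⧸ ⟨v⟩`** for `⟨v⟩ ⊴ G₀` (Mathlib `IsGalois.normalAutEquivQuotient` and `QuotientGroup.congr`
along `e`). [folklore] -/
theorem exists_mulEquiv_fixedField_quotient (e : (K ≃ₐ[ℚ] K) ≃* G₀) (v : G₀) [(Subgroup.zpowers v).Normal] :
    Nonempty (((IntermediateField.fixedField ((Subgroup.zpowers v).comap (e : (K ≃ₐ[ℚ] K) →* G₀))) ≃ₐ[ℚ]
      (IntermediateField.fixedField ((Subgroup.zpowers v).comap (e : (K ≃ₐ[ℚ] K) →* G₀)))) ≃*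
        G₀ ⧸ Subgroup.zpowers v) := by
  set H : Subgroup (K ≃ₐ[ℚ] K) := (Subgroup.zpowers v).comap (e : (K ≃ₐ[ℚ] K) →* G₀) with hH_def
  haveI : H.Normal := Subgroup.normal_comap _
  have he : H.map (e : (K ≃ₐ[ℚ] K) →* G₀) = Subgroup.zpowers v :=
    Subgroup.map_comap_eq_self_of_surjective e.surjective _
  exact ⟨(IsGalois.normalAutEquivQuotient H).symm.trans (QuotientGroup.congr H (Subgroup.zpowers v) e he)⟩

omit [Fintype G₀] [IsCMField K] [IsGalois ℚ K] in
/-- **Degree of the fixed field**: `[K^{e⁻¹⟨v⟩} : ℚ] · orderOf v = [K : ℚ]`. [folklore] -/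
theorem finrank_fixedField_comap_zpowers (e : (K ≃ₐ[ℚ] K) ≃* G₀) (v : G₀) :
    Module.finrank ℚ (IntermediateField.fixedField ((Subgroup.zpowers v).comap (e : (K ≃ₐ[ℚ] K) →* G₀))) *
      orderOf v = Module.finrank ℚ K := by
  have h := FaceCensus.finrank_fixedField_mul_card ((Subgroup.zpowers v).comap (e : (K ≃ₐ[ℚ] K) →* G₀))
  have he : ((Subgroup.zpowers v).comap (e : (K ≃ₐ[ℚ] K) →* G₀)).map (e : (K ≃ₐ[ℚ] K) →* G₀) =
      Subgroup.zpowers v :=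
    Subgroup.map_comap_eq_self_of_surjective e.surjective _
  have hcard : Nat.card ((Subgroup.zpowers v).comap (e : (K ≃ₐ[ℚ] K) →* G₀)) = orderOf v := by
    have h1 := Subgroup.card_map_of_injective (K := (Subgroup.zpowers v).comap (e : (K ≃ₐ[ℚ] K) →* G₀))
      (f := (e : (K ≃ₐ[ℚ] K) →* G₀)) (fun a b h => e.injective h)
    rw [he, Nat.card_zpowers] at h1
    exact h1.symm
  rw [hcard] at h
  exact h

end Summit.HodgeConjecture.CorCM.GaloisRank

end
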